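import Literature.NumberTheory.Rogawski1990.UnitaryVertexStabilizerSpanCM         -- ★ A-p16: `exists_uniformizer_adicCompletion`, the 1-deep locus pattern (`continuous_endoEmbLocal`)
import Literature.NumberTheory.Rogawski1990.UnitFundamentalLemmaInertLeviClause     -- ★ `charpoly_map_endoEmbLocal_conj` (+ ★ `endoEmbLocal_eq_glDiagonal_of_fst_eq`)
import HarnessLib

/-!
# Near `1`, every Levi-type class of `H_v` is 2-DEEP: the eigenvalues of `ι_v(yγ_Hy⁻¹) = diag(d)` satisfy `|d_{k,w} − 1|_w ≤ |ϖ_w|²`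
(Rogawski (1990) §4.9 p. 54, §3.1 p. 19)

Topic `NumberTheory/Rogawski1990`; namespace `Literature.NumberTheory.Rogawski1990`.  KERNEL mathematics only: theorems, no definition, no named fact, no instance,
no notation, no `sorry`.  Cell `pub/hodgecm-mathlib`, road «S3-tree», T3′ «DEPTH-ZERO κ-TRANSFER», the level-2 LIFT organ (L) `stub_liftLevi`, sub-organ
**(O1″) «NEAR-1 ⇒ 2-DEEP»** (architect A-142; seat F0P3a-p04 (g17); consumer F0P3-p02's assembly `liftLevi_of_organs` BY NAME).  HONEST LABEL: HC_CM is proved only modulo the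
2 remaining named inputs (hLiu418, h413) until rung 0 closes; this file discharges no named fact.

THE MATHEMATICS.  (§1, any `ℤᵐ⁰`-valued field `K`) eigenvalues of an integral matrix are integral (`|coeffᵢ χ_B| ≤ 1` from ★ Mathlib `Matrix.charpoly_map` over `𝒪`, then
domination of the cubic term — the «part (a)» of ★ A-p12 `valuation_sub_one_lt_one_of_isRoot_charpoly_of_residuallyUnipotent`); `χ_M(λ) = 0 ⟹ χ_{c⁻¹(M − 1)}(c⁻¹(λ − 1)) = 0`
(`Matrix.eval_charpoly`, `det_smul`); hence **`M ≡ 1 (mod c)` entrywise ⟹ every eigenvalue `λ ∈ K` of `M` is `≡ 1 (mod c)`**.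
(§2, the CM place) `V := {γ_H ∈ H_v | ι_v(γ_H)_w ≡ 1 (mod ϖ_w²) entrywise} ∈ 𝓝 1` (continuity of `ι_v`, closed balls are open); `χ(ι_v(yγ_Hy⁻¹)_w) = χ(ι_v(γ_H)_w)`
(★ `charpoly_map_endoEmbLocal_conj`) and on the Levi stratum `ι_v(yγ_Hy⁻¹) = diag(d)` its roots are the `d_{k,w}`: **`|d_{k,w} − 1|_w ≤ exp(−2) = |ϖ_w|²`** uniformly on `V`
— the 2-deep guard under which the level-2 piece `g` of `stub_liftLevi` reads the five strata values (organ (V)) along `tN`.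
* §1 `valued_le_one_of_isRoot_charpoly_of_forall_valued_le_one`, `isRoot_charpoly_smul_sub_one`, `valued_sub_one_le_of_isRoot_charpoly_of_congr_one`, `valued_lt_one_of_le_exp_neg_two`, `isOpen_setOf_valued_le_valued`.
* §2 `exists_nhds_one_twoDeep_endoEmbLocal`, `valued_sub_one_le_exp_neg_two_of_twoDeep_of_endoEmbLocal_conj_eq`, `…_of_fst_conj_eq`, HEAD `exists_nhds_one_forall_levi_twoDeep`.

## References
* [Rogawski1990] J. D. Rogawski, *Automorphic Representations of Unitary Groups in Three Variables*, Ann. of Math. Stud. 123 (1990), §3.1 p. 19; §4.9 p. 54.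
* [BernsteinZelevinsky1976] I. N. Bernstein, A. V. Zelevinsky, *Representations of the group GL(n, F) where F is a non-archimedean local field*, §1.1 (neighbourhood bases).
* [CasselsFrohlichANT1967] J. W. S. Cassels, A. Fröhlich (eds.), *Algebraic Number Theory* (1967), Ch. II §10 (integrality of roots of monic integral polynomials).
-/

set_option autoImplicit false

noncomputable section

open NumberField IsDedekindDomain Matrix Polynomial Topology Filter
open scoped Matrix MatrixGroups

namespace Literature.NumberTheory.Rogawski1990

open Literature.NumberTheory.Automorphic Literature.NumberTheory.Automorphic.UnitaryGroup

/-! ## §1 Eigenvalues of a matrix congruent to `1` -/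

section Valued

variable {K : Type*} [Field K] [Valued K (WithZero (Multiplicative ℤ))]

/-- **Eigenvalues of an INTEGRAL matrix are integral**: if `|B_{ij}| ≤ 1` and `χ_B(x) = 0` then `|x| ≤ 1` (`χ_B` is monic with integral coefficients — ★ Mathlib
`Matrix.charpoly_map` over the valuation ring —, and `x³ = −(c₂x² + c₁x + c₀)` is impossible for `|x| > 1`). [cite: CasselsFrohlichANT1967, Ch. II §10]
[cite: Rogawski1990, §3.1 p. 19] -/
theorem valued_le_one_of_isRoot_charpoly_of_forall_valued_le_one (B : Matrix (Fin 3) (Fin 3) K) (hB : ∀ i j, Valued.v (B i j) ≤ 1)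
    {x : K} (hx : B.charpoly.IsRoot x) : Valued.v x ≤ 1 := by
  -- integral coefficients
  have hcoef : ∀ i, Valued.v (B.charpoly.coeff i) ≤ 1 := by
    let B₀ : Matrix (Fin 3) (Fin 3) ↥(Valued.v : Valuation K (WithZero (Multiplicative ℤ))).integer :=
      Matrix.of fun i j => ⟨B i j, (Valuation.mem_integer_iff _ _).2 (hB i j)⟩
    have hB₀ : B = B₀.map (Valued.v : Valuation K (WithZero (Multiplicative ℤ))).integer.subtype := by
      ext i j; rfl
    intro i
    rw [hB₀, Matrix.charpoly_map, Polynomial.coeff_map]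
    exact (Valuation.mem_integer_iff _ _).1 (B₀.charpoly.coeff i).2
  have hdeg : B.charpoly.natDegree = 3 := by rw [Matrix.charpoly_natDegree_eq_dim, Fintype.card_fin]
  have hc3 : B.charpoly.coeff 3 = 1 := by
    have h3 := (Matrix.charpoly_monic B).coeff_natDegree; rwa [hdeg] at h3
  by_contra hlt
  rw [not_le] at hlt
  have heval : B.charpoly.coeff 0 + B.charpoly.coeff 1 * x + B.charpoly.coeff 2 * x ^ 2 + x ^ 3 = 0 := by
    have h0 := hx.eq_zero
    rw [Polynomial.eval_eq_sum_range, hdeg] at h0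
    simpa only [Finset.sum_range_succ, Finset.sum_range_zero, zero_add, pow_zero, mul_one, pow_one, hc3, one_mul] using h0
  have e : x ^ 3 = -(B.charpoly.coeff 0 + B.charpoly.coeff 1 * x + B.charpoly.coeff 2 * x ^ 2) := by linear_combination heval
  have key : Valued.v x ^ 3 ≤ Valued.v x ^ 2 := by
    rw [← Valuation.map_pow, e, Valuation.map_neg]
    refine (Valuation.map_add _ _ _).trans (max_le ((Valuation.map_add _ _ _).trans (max_le ?_ ?_)) ?_)
    · exact (hcoef 0).trans (one_le_pow₀ hlt.le)
    · rw [Valuation.map_mul]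
      calc Valued.v (B.charpoly.coeff 1) * Valued.v x ≤ 1 * Valued.v x := mul_le_mul' (hcoef 1) le_rfl
        _ = Valued.v x ^ 1 := by rw [one_mul, pow_one]
        _ ≤ Valued.v x ^ 2 := pow_le_pow_right₀ hlt.le (by norm_num)
    · rw [Valuation.map_mul, Valuation.map_pow]
      calc Valued.v (B.charpoly.coeff 2) * Valued.v x ^ 2 ≤ 1 * Valued.v x ^ 2 := mul_le_mul' (hcoef 2) le_rfl
        _ = Valued.v x ^ 2 := one_mul _
  exact absurd key (not_le_of_gt (pow_lt_pow_right₀ hlt (by norm_num)))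

omit [Valued K (WithZero (Multiplicative ℤ))] in
/-- **Shift and scale**: `χ_M(x) = 0 ⟹ χ_{c⁻¹(M − 1)}(c⁻¹(x − 1)) = 0` (any `c`; `det(c⁻¹(x·1 − M)) = c⁻³ det(x·1 − M)`, ★ Mathlib `Matrix.eval_charpoly`).
[cite: Rogawski1990, §3.1 p. 19] -/
theorem isRoot_charpoly_smul_sub_one (M : Matrix (Fin 3) (Fin 3) K) (c : K) {x : K} (hx : M.charpoly.IsRoot x) :
    (c⁻¹ • (M - 1)).charpoly.IsRoot (c⁻¹ * (x - 1)) := by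
  rw [Polynomial.IsRoot.def, Matrix.eval_charpoly] at hx ⊢
  have h : Matrix.scalar (Fin 3) (c⁻¹ * (x - 1)) - c⁻¹ • (M - 1) = c⁻¹ • (Matrix.scalar (Fin 3) x - M) := by
    ext i j
    simp only [Matrix.scalar_apply, Matrix.sub_apply, Matrix.smul_apply, Matrix.diagonal_apply, Matrix.one_apply, smul_eq_mul]
    split_ifs <;> ring
  rw [h, Matrix.det_smul, hx, mul_zero]

/-- **`M ≡ 1 (mod c)` ENTRYWISE ⟹ EVERY EIGENVALUE IS `≡ 1 (mod c)`**: if `|M_{ij} − δ_{ij}| ≤ |c|` (`c ≠ 0`) and `χ_M(x) = 0` then `|x − 1| ≤ |c|`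
(apply the integrality of eigenvalues to `c⁻¹(M − 1)`). [cite: CasselsFrohlichANT1967, Ch. II §10] [cite: Rogawski1990, §3.1 p. 19; §4.9 p. 54] -/
theorem valued_sub_one_le_of_isRoot_charpoly_of_congr_one (M : Matrix (Fin 3) (Fin 3) K) {c : K} (hc : c ≠ 0)
    (hM : ∀ i j, Valued.v (M i j - (1 : Matrix (Fin 3) (Fin 3) K) i j) ≤ Valued.v c) {x : K} (hx : M.charpoly.IsRoot x) :
    Valued.v (x - 1) ≤ Valued.v c := by
  have hvc : Valued.v c ≠ 0 := (Valuation.ne_zero_iff _).2 hc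
  have hB : ∀ i j, Valued.v ((c⁻¹ • (M - 1)) i j) ≤ 1 := by
    intro i j
    rw [Matrix.smul_apply, Matrix.sub_apply, smul_eq_mul, Valuation.map_mul, map_inv₀]
    calc (Valued.v c)⁻¹ * Valued.v (M i j - (1 : Matrix (Fin 3) (Fin 3) K) i j) ≤ (Valued.v c)⁻¹ * Valued.v c := mul_le_mul_right (hM i j) _
      _ = 1 := inv_mul_cancel₀ hvc
  have h := valued_le_one_of_isRoot_charpoly_of_forall_valued_le_one (c⁻¹ • (M - 1)) hB (isRoot_charpoly_smul_sub_one M c hx)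
  rw [Valuation.map_mul, map_inv₀] at h
  calc Valued.v (x - 1) = Valued.v c * ((Valued.v c)⁻¹ * Valued.v (x - 1)) := by rw [← mul_assoc, mul_inv_cancel₀ hvc, one_mul]
    _ ≤ Valued.v c * 1 := mul_le_mul_right h _
    _ = Valued.v c := mul_one _

/-- **2-deep ⇒ 1-deep** (`exp(−2) < 1 = exp 0`): the `hdeep1` bookkeeping of the parametric (O5-core) (A-149). [cite: BernsteinZelevinsky1976, §1.1] -/
theorem valued_lt_one_of_le_exp_neg_two {x : K} (h : Valued.v x ≤ WithZero.exp (-2 : ℤ)) : Valued.v x < 1 :=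
  h.trans_lt (by rw [← WithZero.exp_zero]; exact WithZero.exp_lt_exp.2 (by norm_num))

/-- The closed ball `{x | |x| ≤ |c|}` (`c ≠ 0`) is OPEN: it is the preimage of the (open) valuation ring under `x ↦ c⁻¹x`. [cite: BernsteinZelevinsky1976, §1.1] -/
theorem isOpen_setOf_valued_le_valued {c : K} (hc : c ≠ 0) : IsOpen {x : K | Valued.v x ≤ Valued.v c} := by
  have hvc : Valued.v c ≠ 0 := (Valuation.ne_zero_iff _).2 hc
  have hset : {x : K | Valued.v x ≤ Valued.v c} = (fun x => c⁻¹ * x) ⁻¹' ((Valued.v : Valuation K (WithZero (Multiplicative ℤ))).integer : Set K) := by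
    ext x
    simp only [Set.mem_setOf_eq, Set.mem_preimage, SetLike.mem_coe, Valuation.mem_integer_iff, map_mul, map_inv₀]
    constructor
    · intro h
      calc (Valued.v c)⁻¹ * Valued.v x ≤ (Valued.v c)⁻¹ * Valued.v c := mul_le_mul_right h _
        _ = 1 := inv_mul_cancel₀ hvc
    · intro h
      calc Valued.v x = Valued.v c * ((Valued.v c)⁻¹ * Valued.v x) := by rw [← mul_assoc, mul_inv_cancel₀ hvc, one_mul]
        _ ≤ Valued.v c * 1 := mul_le_mul_right h _
        _ = Valued.v c := mul_one _
  rw [hset]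
  exact (Valued.isClopen_integer K).isOpen.preimage (continuous_const.mul continuous_id)

end Valued

/-! ## §2 The CM place: the 2-deep neighbourhood of `1 ∈ H_v` and the Levi stratum -/

section CM

variable (L : Type) [Field L] [NumberField L] [IsCMField L] (v : HeightOneSpectrum (𝓞 ↥(maximalRealSubfield L))) (w : PlacesOver L v)

set_option maxHeartbeats 1600000 in
set_option synthInstance.maxHeartbeats 400000 in
-- cold instance-term unification on the CM local carriers (as in ★ FILE D)
/-- **`ι_v(γ_H)_w ≡ 1 (mod ϖ_w²)` ENTRYWISE FOR ALL `γ_H` NEAR `1 ∈ H_v`** (`|·|_w ≤ exp(−2)`; the locus is open by continuity of `ι_v` — ★ `continuous_endoEmbLocal` — and of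
the entries, closed balls being open; it contains `1`). [cite: Rogawski1990, §4.9 p. 54] [cite: BernsteinZelevinsky1976, §1.1] -/
theorem exists_nhds_one_twoDeep_endoEmbLocal :
    ∃ V ∈ 𝓝 (1 : (cmDatum L 2 (Matrix.of fun i j : Fin 2 => if i.val + j.val + 1 = 2 then (1 : L) else 0)).Local v ×
        (cmDatum L 1 (Matrix.of fun i j : Fin 1 => if i.val + j.val + 1 = 1 then (1 : L) else 0)).Local v),
      ∀ γH ∈ V, ∀ a b : Fin 3, Valued.v ((((((endoEmbLocal L v γH).val : GL (Fin 3) (UnitaryGroup.LocalRing L v)) : Matrix (Fin 3) (Fin 3) (UnitaryGroup.LocalRing L v)).map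
        (Pi.evalRingHom (fun w' : PlacesOver L v => w'.1.adicCompletion L) w)) a b - (1 : Matrix (Fin 3) (Fin 3) (w.1.adicCompletion L)) a b)) ≤
          WithZero.exp (-2 : ℤ) := by
  obtain ⟨ϖ, hϖ⟩ := exists_uniformizer_adicCompletion L v w
  have hϖ0 : ϖ ≠ 0 := fun h => by rw [h, map_zero] at hϖ; exact WithZero.coe_ne_zero hϖ.symm
  have hϖ2 : Valued.v (ϖ ^ 2) = WithZero.exp (-2 : ℤ) := by
    rw [Valuation.map_pow, hϖ, ← WithZero.exp_nsmul]; norm_num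
  have hcont : Continuous fun γH : (cmDatum L 2 (Matrix.of fun i j : Fin 2 => if i.val + j.val + 1 = 2 then (1 : L) else 0)).Local v ×
        (cmDatum L 1 (Matrix.of fun i j : Fin 1 => if i.val + j.val + 1 = 1 then (1 : L) else 0)).Local v =>
      ((((endoEmbLocal L v γH).val : GL (Fin 3) (UnitaryGroup.LocalRing L v)) : Matrix (Fin 3) (Fin 3) (UnitaryGroup.LocalRing L v)).map
        (Pi.evalRingHom (fun w' : PlacesOver L v => w'.1.adicCompletion L) w)) := by
    refine Continuous.matrix_map ?_ (continuous_apply w)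
    exact Units.continuous_val.comp (continuous_subtype_val.comp (continuous_endoEmbLocal L v))
  -- the open locus `⋂_{a,b} {γ_H | |(ι_v(γ_H)_w − 1)_{ab}| ≤ |ϖ²|}` contains `1`
  have hopen : IsOpen (⋂ a : Fin 3, ⋂ b : Fin 3,
      (fun γH : (cmDatum L 2 (Matrix.of fun i j : Fin 2 => if i.val + j.val + 1 = 2 then (1 : L) else 0)).Local v ×
          (cmDatum L 1 (Matrix.of fun i j : Fin 1 => if i.val + j.val + 1 = 1 then (1 : L) else 0)).Local v =>
        (((((endoEmbLocal L v γH).val : GL (Fin 3) (UnitaryGroup.LocalRing L v)) : Matrix (Fin 3) (Fin 3) (UnitaryGroup.LocalRing L v)).map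
          (Pi.evalRingHom (fun w' : PlacesOver L v => w'.1.adicCompletion L) w)) a b - (1 : Matrix (Fin 3) (Fin 3) (w.1.adicCompletion L)) a b)) ⁻¹'
        {x : w.1.adicCompletion L | Valued.v x ≤ Valued.v (ϖ ^ 2)}) :=
    isOpen_iInter_of_finite fun a => isOpen_iInter_of_finite fun b =>
      (isOpen_setOf_valued_le_valued (pow_ne_zero 2 hϖ0)).preimage (((continuous_apply b).comp ((continuous_apply a).comp hcont)).sub continuous_const)
  have h1 : ((1 : (cmDatum L 3 (Matrix.of fun i j : Fin 3 => if i.val + j.val + 1 = 3 then (1 : L) else 0)).Local v).val :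
      GL (Fin 3) (UnitaryGroup.LocalRing L v)) = 1 := rfl
  have hmem : (1 : (cmDatum L 2 (Matrix.of fun i j : Fin 2 => if i.val + j.val + 1 = 2 then (1 : L) else 0)).Local v ×
        (cmDatum L 1 (Matrix.of fun i j : Fin 1 => if i.val + j.val + 1 = 1 then (1 : L) else 0)).Local v) ∈ ⋂ a : Fin 3, ⋂ b : Fin 3,
      (fun γH : (cmDatum L 2 (Matrix.of fun i j : Fin 2 => if i.val + j.val + 1 = 2 then (1 : L) else 0)).Local v ×
          (cmDatum L 1 (Matrix.of fun i j : Fin 1 => if i.val + j.val + 1 = 1 then (1 : L) else 0)).Local v =>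
        (((((endoEmbLocal L v γH).val : GL (Fin 3) (UnitaryGroup.LocalRing L v)) : Matrix (Fin 3) (Fin 3) (UnitaryGroup.LocalRing L v)).map
          (Pi.evalRingHom (fun w' : PlacesOver L v => w'.1.adicCompletion L) w)) a b - (1 : Matrix (Fin 3) (Fin 3) (w.1.adicCompletion L)) a b)) ⁻¹'
        {x : w.1.adicCompletion L | Valued.v x ≤ Valued.v (ϖ ^ 2)} := by
    simp only [Set.mem_iInter, Set.mem_preimage, Set.mem_setOf_eq]
    intro a b
    rw [map_one, h1, Units.val_one, Matrix.map_one _ (map_zero _) (map_one _), sub_self, map_zero]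
    exact zero_le
  refine ⟨_, hopen.mem_nhds hmem, fun γH hγ a b => ?_⟩
  simp only [Set.mem_iInter, Set.mem_preimage, Set.mem_setOf_eq, hϖ2] at hγ
  exact hγ a b

set_option maxHeartbeats 400000 in
-- heartbeat budget: cold instance-term unification on the CM local carriers (buildfix cliff pattern N1)
/-- **2-DEEP + LEVI ⇒ 2-DEEP EIGENVALUES (pointwise).**  If `ι_v(γ_H)_w ≡ 1 (mod ϖ_w²)` entrywise (the text of `exists_nhds_one_twoDeep_endoEmbLocal`) and
`ι_v(yγ_Hy⁻¹) = diag(d)`, then `|d_{k,w} − 1|_w ≤ exp(−2)` for every `k` (`χ` is conjugation invariant ★ `charpoly_map_endoEmbLocal_conj`; the `d_{k,w}` are its roots; §1).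
[cite: Rogawski1990, §3.1 p. 19; §4.9 p. 54] -/
theorem valued_sub_one_le_exp_neg_two_of_twoDeep_of_endoEmbLocal_conj_eq
    (γH y : (cmDatum L 2 (Matrix.of fun i j : Fin 2 => if i.val + j.val + 1 = 2 then (1 : L) else 0)).Local v ×
      (cmDatum L 1 (Matrix.of fun i j : Fin 1 => if i.val + j.val + 1 = 1 then (1 : L) else 0)).Local v)
    (hγV : ∀ a b : Fin 3, Valued.v ((((((endoEmbLocal L v γH).val : GL (Fin 3) (UnitaryGroup.LocalRing L v)) : Matrix (Fin 3) (Fin 3) (UnitaryGroup.LocalRing L v)).map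
        (Pi.evalRingHom (fun w' : PlacesOver L v => w'.1.adicCompletion L) w)) a b - (1 : Matrix (Fin 3) (Fin 3) (w.1.adicCompletion L)) a b)) ≤
          WithZero.exp (-2 : ℤ))
    {d : Fin 3 → (UnitaryGroup.LocalRing L v)ˣ}
    (hι : ((endoEmbLocal L v (y * γH * y⁻¹)).val : GL (Fin 3) (UnitaryGroup.LocalRing L v)) = glDiagonal 3 (UnitaryGroup.LocalRing L v) d) (k : Fin 3) :
    Valued.v ((((d k : (UnitaryGroup.LocalRing L v)ˣ) : UnitaryGroup.LocalRing L v) w) - 1) ≤ WithZero.exp (-2 : ℤ) := by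
  obtain ⟨ϖ, hϖ⟩ := exists_uniformizer_adicCompletion L v w
  have hϖ0 : ϖ ≠ 0 := fun h => by rw [h, map_zero] at hϖ; exact WithZero.coe_ne_zero hϖ.symm
  have hϖ2 : Valued.v (ϖ ^ 2) = WithZero.exp (-2 : ℤ) := by
    rw [Valuation.map_pow, hϖ, ← WithZero.exp_nsmul]; norm_num
  rw [← hϖ2] at hγV ⊢
  refine valued_sub_one_le_of_isRoot_charpoly_of_congr_one _ (pow_ne_zero 2 hϖ0) hγV ?_
  -- `χ(ι_v(γ_H)_w) = χ(ι_v(yγ_Hy⁻¹)_w) = χ(diag(d_w)) = ∏ (X − d_{k,w})`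
  have hch := charpoly_map_endoEmbLocal_conj L w y γH
  rw [hι, coe_glDiagonal, Matrix.diagonal_map (RingHom.map_zero (Pi.evalRingHom (fun w' : PlacesOver L v => w'.1.adicCompletion L) w)),
    Matrix.charpoly_diagonal] at hch
  rw [Polynomial.IsRoot.def, ← hch, Polynomial.eval_prod]
  exact Finset.prod_eq_zero (Finset.mem_univ k) (by rw [eval_sub, eval_X, eval_C]; exact sub_self _)

set_option maxHeartbeats 400000 in
-- heartbeat budget: cold instance-term unification on the CM local carriers (buildfix cliff pattern N1)
/-- **The same in the tokens of HEAD v4's Levi hypothesis** `glDiagonal 2 d′ = (yγ_Hy⁻¹).1`: all three entries of `d = (d′₀, u, d′₁)`,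
`u = (isUnit_finGammaTwo L v (yγ_Hy⁻¹)).unit` (★ `endoEmbLocal_eq_glDiagonal_of_fst_eq`), are `≡ 1 (mod ϖ_w²)`. [cite: Rogawski1990, §3.1 p. 19; §4.9 p. 54] -/
theorem valued_sub_one_le_exp_neg_two_of_twoDeep_of_fst_conj_eq
    (γH y : (cmDatum L 2 (Matrix.of fun i j : Fin 2 => if i.val + j.val + 1 = 2 then (1 : L) else 0)).Local v ×
      (cmDatum L 1 (Matrix.of fun i j : Fin 1 => if i.val + j.val + 1 = 1 then (1 : L) else 0)).Local v)
    (hγV : ∀ a b : Fin 3, Valued.v ((((((endoEmbLocal L v γH).val : GL (Fin 3) (UnitaryGroup.LocalRing L v)) : Matrix (Fin 3) (Fin 3) (UnitaryGroup.LocalRing L v)).map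
        (Pi.evalRingHom (fun w' : PlacesOver L v => w'.1.adicCompletion L) w)) a b - (1 : Matrix (Fin 3) (Fin 3) (w.1.adicCompletion L)) a b)) ≤
          WithZero.exp (-2 : ℤ))
    {d' : Fin 2 → (UnitaryGroup.LocalRing L v)ˣ}
    (hd' : glDiagonal 2 (UnitaryGroup.LocalRing L v) d' = ((y * γH * y⁻¹).1.val : GL (Fin 2) (UnitaryGroup.LocalRing L v))) (k : Fin 3) :
    Valued.v ((((![d' 0, (isUnit_finGammaTwo L v (y * γH * y⁻¹)).unit, d' 1] k : (UnitaryGroup.LocalRing L v)ˣ) : UnitaryGroup.LocalRing L v) w) - 1) ≤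
      WithZero.exp (-2 : ℤ) :=
  valued_sub_one_le_exp_neg_two_of_twoDeep_of_endoEmbLocal_conj_eq L v w γH y hγV (endoEmbLocal_eq_glDiagonal_of_fst_eq L v (y * γH * y⁻¹) hd') k

set_option maxHeartbeats 400000 in
-- heartbeat budget: cold instance-term unification on the CM local carriers (buildfix cliff pattern N1)
/-- **NEAR `1`, LEVI ⇒ 2-DEEP (the uniform neighbourhood; HEAD of organ (O1″)).**  There is `V ∈ 𝓝 (1 : H_v)` (`exists_nhds_one_twoDeep_endoEmbLocal`) such that for
every `γ_H ∈ V`, every `y ∈ H_v` and every `d` with `ι_v(yγ_Hy⁻¹) = diag(d)`: `|d_{k,w} − 1|_w ≤ exp(−2) = |ϖ_w|²` for all `k` — the 2-deep twin of ★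
`exists_nhds_one_forall_levi_deep`. [cite: Rogawski1990, §3.1 p. 19; §4.9 p. 54] [cite: BernsteinZelevinsky1976, §1.1] -/
theorem exists_nhds_one_forall_levi_twoDeep :
    ∃ V ∈ 𝓝 (1 : (cmDatum L 2 (Matrix.of fun i j : Fin 2 => if i.val + j.val + 1 = 2 then (1 : L) else 0)).Local v ×
        (cmDatum L 1 (Matrix.of fun i j : Fin 1 => if i.val + j.val + 1 = 1 then (1 : L) else 0)).Local v),
      ∀ γH ∈ V, ∀ y : (cmDatum L 2 (Matrix.of fun i j : Fin 2 => if i.val + j.val + 1 = 2 then (1 : L) else 0)).Local v ×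
          (cmDatum L 1 (Matrix.of fun i j : Fin 1 => if i.val + j.val + 1 = 1 then (1 : L) else 0)).Local v,
        ∀ d : Fin 3 → (UnitaryGroup.LocalRing L v)ˣ,
          ((endoEmbLocal L v (y * γH * y⁻¹)).val : GL (Fin 3) (UnitaryGroup.LocalRing L v)) = glDiagonal 3 (UnitaryGroup.LocalRing L v) d →
            ∀ k : Fin 3, Valued.v ((((d k : (UnitaryGroup.LocalRing L v)ˣ) : UnitaryGroup.LocalRing L v) w) - 1) ≤ WithZero.exp (-2 : ℤ) :=
  let ⟨V, hV, hVd⟩ := exists_nhds_one_twoDeep_endoEmbLocal L v w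
  ⟨V, hV, fun γH hγV y _ hι k => valued_sub_one_le_exp_neg_two_of_twoDeep_of_endoEmbLocal_conj_eq L v w γH y (hVd γH hγV) hι k⟩

end CM

end Literature.NumberTheory.Rogawski1990

end
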